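import Summits.Ventures.PercRepro.C041ZonePortForced

/-!
# The zone port problem of THEOREM R: CASE (ii) — a gate carrying both terminal types (p6, gen 24)

Setting of `C041ZonePortDefs` (mine-3, C-041.md §3 (ii) / §6 (c), general multiplicities).  If some gate zone `C`
carries a 1-edge `e₁` and a 2-edge `e₂`, then `0 ≤ Φ∨ P` and `0 ≤ Φ∧ P` — by the paper's count
`4 + (2^{k₁} − 2) − 2 + (2^{k₂} − 2) − 2 ≥ 0` in charging form: the admissible valid patterns with ALL edges at `C`
red have weight `4` (both sides Good by THE KEY FACT), those with all 1-edges at `C` blue (then all 2-edges red by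
admissibility) and those with all 2-edges at `C` blue have weight `≥ −2`, every other pattern has a blue edge and a
red edge of the same side at `C` and weight `≥ 1`; REDDENING ALL EDGES AT `C` injects each of the two blue classes into
the all-red class (they agree at `C`), so `Φ ≥ 4·#RR − 2·#B₁ − 2·#B₂ ≥ 0`.

* `redden`, `adm_redden`, `X₁_redden`, `X₂_redden`, `redden_injOn₁` / `redden_injOn₂`;
* `weight_eq_four_of_allRed`, `one_le_weight_of_mixed`;
* `phi_nonneg_of_twoType_gate` — the case for any validity predicate kept by reddening;
* **`phiOr_nonneg_of_twoType_gate`**, **`phiAnd_nonneg_of_twoType_gate`**.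
-/

namespace PercRepro

namespace ZonePort

namespace Problem

open Finset

variable {V E : Type*} {P : Problem V E}

/-- All edges at the zone `C` are red. -/
def AllRed (P : Problem V E) (C : Finset V) (x : P.Term → Bool) : Prop :=
  ∀ f : P.Term, P.tz f.1 = C → x f = true

/-- All 1-edges at the zone `C` are blue. -/
def AllBlue₁ (P : Problem V E) (C : Finset V) (x : P.Term → Bool) : Prop :=
  ∀ f : P.Term, P.tz f.1 = C → P.ts f.1 = false → x f = false

/-- All 2-edges at the zone `C` are blue. -/
def AllBlue₂ (P : Problem V E) (C : Finset V) (x : P.Term → Bool) : Prop :=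
  ∀ f : P.Term, P.tz f.1 = C → P.ts f.1 = true → x f = false

section Redden

variable [DecidableEq V]

/-- Reddening all edges at the zone `C`. -/
def redden (P : Problem V E) (C : Finset V) (x : P.Term → Bool) : P.Term → Bool :=
  fun f => if P.tz f.1 = C then true else x f

/-- Reddening at `C` gives a red edge at `C`. -/
theorem redden_of_tz (C : Finset V) (x : P.Term → Bool) {f : P.Term} (hf : P.tz f.1 = C) :
    P.redden C x f = true := by
  unfold redden
  rw [if_pos hf]

/-- Reddening at `C` changes nothing elsewhere. -/
theorem redden_of_ne (C : Finset V) (x : P.Term → Bool) {f : P.Term} (hf : P.tz f.1 ≠ C) :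
    P.redden C x f = x f := by
  unfold redden
  rw [if_neg hf]

/-- A reddened pattern is all red at `C`. -/
theorem allRed_redden (C : Finset V) (x : P.Term → Bool) : P.AllRed C (P.redden C x) :=
  fun _ hf => redden_of_tz C x hf

/-- Reddening keeps admissibility. -/
theorem adm_redden {x : P.Term → Bool} (hx : P.Adm x) (C : Finset V) : P.Adm (P.redden C x) := by
  refine ⟨fun f hf => ?_, fun f g hfg hf hg => ?_⟩
  · by_cases hfC : P.tz f.1 = C
    · exact redden_of_tz C x hfC
    · rw [redden_of_ne C x hfC]
      exact hx.1 f hf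
  · by_cases hfC : P.tz f.1 = C
    · exact Or.inl (redden_of_tz C x hfC)
    · have hgC : P.tz g.1 ≠ C := fun h => hfC (hfg.trans h)
      rw [redden_of_ne C x hfC, redden_of_ne C x hgC]
      exact hx.2 f g hfg hf hg

/-- Reddening keeps `X₁`. -/
theorem X₁_redden {x : P.Term → Bool} (hx : P.X₁ x) (C : Finset V) : P.X₁ (P.redden C x) := by
  obtain ⟨f, hf, hxf⟩ := hx
  refine ⟨f, hf, ?_⟩
  by_cases hfC : P.tz f.1 = C
  · exact redden_of_tz C x hfC
  · rw [redden_of_ne C x hfC]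
    exact hxf

/-- Reddening keeps `X₂`. -/
theorem X₂_redden {x : P.Term → Bool} (hx : P.X₂ x) (C : Finset V) : P.X₂ (P.redden C x) := by
  obtain ⟨f, hf, hxf⟩ := hx
  refine ⟨f, hf, ?_⟩
  by_cases hfC : P.tz f.1 = C
  · exact redden_of_tz C x hfC
  · rw [redden_of_ne C x hfC]
    exact hxf

/-- Reddening at `C` is injective on the admissible patterns with all 1-edges at `C` blue, provided `C` carries a
1-edge (then all 2-edges at `C` are red by admissibility, so the patterns agree at `C`). -/
theorem redden_injOn₁ {C : Finset V} {e₁ : P.Term} (he₁ : P.tz e₁.1 = C) (hs₁ : P.ts e₁.1 = false) :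
    Set.InjOn (P.redden C) {x | P.Adm x ∧ P.AllBlue₁ C x} := by
  intro x hx y hy hxy
  funext f
  by_cases hfC : P.tz f.1 = C
  · cases hs : P.ts f.1
    · rw [hx.2 f hfC hs, hy.2 f hfC hs]
    · have hx1 : x e₁ = false := hx.2 e₁ he₁ hs₁
      have hy1 : y e₁ = false := hy.2 e₁ he₁ hs₁
      have hxf : x f = true := by
        rcases hx.1.2 e₁ f (he₁.trans hfC.symm) hs₁ hs with h | h
        · rw [hx1] at h
          exact Bool.noConfusion h
        · exact h
      have hyf : y f = true := by
        rcases hy.1.2 e₁ f (he₁.trans hfC.symm) hs₁ hs with h | h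
        · rw [hy1] at h
          exact Bool.noConfusion h
        · exact h
      rw [hxf, hyf]
  · have := congrFun hxy f
    rw [redden_of_ne C x hfC, redden_of_ne C y hfC] at this
    exact this

/-- Reddening at `C` is injective on the admissible patterns with all 2-edges at `C` blue, provided `C` carries a
2-edge. -/
theorem redden_injOn₂ {C : Finset V} {e₂ : P.Term} (he₂ : P.tz e₂.1 = C) (hs₂ : P.ts e₂.1 = true) :
    Set.InjOn (P.redden C) {x | P.Adm x ∧ P.AllBlue₂ C x} := by
  intro x hx y hy hxy
  funext f
  by_cases hfC : P.tz f.1 = C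
  · cases hs : P.ts f.1
    · have hx2 : x e₂ = false := hx.2 e₂ he₂ hs₂
      have hy2 : y e₂ = false := hy.2 e₂ he₂ hs₂
      have hxf : x f = true := by
        rcases hx.1.2 f e₂ (hfC.trans he₂.symm) hs hs₂ with h | h
        · exact h
        · rw [hx2] at h
          exact Bool.noConfusion h
      have hyf : y f = true := by
        rcases hy.1.2 f e₂ (hfC.trans he₂.symm) hs hs₂ with h | h
        · exact h
        · rw [hy2] at h
          exact Bool.noConfusion h
      rw [hxf, hyf]
    · rw [hx.2 f hfC hs, hy.2 f hfC hs]
  · have := congrFun hxy f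
    rw [redden_of_ne C x hfC, redden_of_ne C y hfC] at this
    exact this

end Redden

section Weights

variable {C : Finset V} {e₁ e₂ : P.Term}

open Classical in
/-- **All edges red at a two-type gate**: both sides are Good, weight `4`. -/
theorem weight_eq_four_of_allRed (hC : P.IsGate C) (he₁ : P.tz e₁.1 = C) (he₂ : P.tz e₂.1 = C)
    (hs₁ : P.ts e₁.1 = false) (hs₂ : P.ts e₂.1 = true) {x : P.Term → Bool} (hx : P.AllRed C x) :
    P.weight x = 4 := by
  have hC₁ : P.IsGate (P.tz e₁.1) := he₁ ▸ hC
  have hC₂ : P.IsGate (P.tz e₂.1) := he₂ ▸ hC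
  refine weight_eq_four_of_good ?_ ?_
  · exact good₁_of_red_gate hC₂ hs₂ (hx e₂ he₂) (fun f hf _ => hx f (hf.trans he₂))
  · exact good₂_of_red_gate hC₁ hs₁ (hx e₁ he₁) (fun f hf _ => hx f (hf.trans he₁))

open Classical in
/-- **A mixed colouring at a two-type gate**: an admissible pattern that is neither all red nor all blue on a side at
the gate `C` has a blue edge and a red edge of the same side there, hence a Good side and weight `≥ 1`. -/
theorem one_le_weight_of_mixed (hC : P.IsGate C) {x : P.Term → Bool} (hx : P.Adm x)
    (hRR : ¬ P.AllRed C x) (hB₁ : ¬ P.AllBlue₁ C x) (hB₂ : ¬ P.AllBlue₂ C x) : 1 ≤ P.weight x := by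
  apply one_le_weight_of_good
  unfold AllRed at hRR
  push Not at hRR
  obtain ⟨f, hfC, hxf⟩ := hRR
  have hxf' : x f = false := by
    cases h : x f
    · rfl
    · exact absurd h hxf
  have hCf : P.IsGate (P.tz f.1) := hfC ▸ hC
  cases hs : P.ts f.1
  · -- a blue 1-edge: all 2-edges at `C` are red; a red 1-edge exists
    unfold AllBlue₁ at hB₁
    push Not at hB₁
    obtain ⟨g, hgC, hgs, hxg⟩ := hB₁
    have hxg' : x g = true := by
      cases h : x g
      · exact absurd h hxg
      · rfl
    have hCg : P.IsGate (P.tz g.1) := hgC ▸ hC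
    refine Or.inr (good₂_of_red_gate hCg hgs hxg' fun k hk hks => ?_)
    rcases hx.2 f k (hfC.trans (hk.trans hgC).symm) hs hks with h | h
    · rw [hxf'] at h
      exact Bool.noConfusion h
    · exact h
  · unfold AllBlue₂ at hB₂
    push Not at hB₂
    obtain ⟨g, hgC, hgs, hxg⟩ := hB₂
    have hxg' : x g = true := by
      cases h : x g
      · exact absurd h hxg
      · rfl
    have hCg : P.IsGate (P.tz g.1) := hgC ▸ hC
    refine Or.inl (good₁_of_red_gate hCg hgs hxg' fun k hk hks => ?_)
    rcases hx.2 k f ((hk.trans hgC).trans hfC.symm) hks hs with h | h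
    · exact h
    · rw [hxf'] at h
      exact Bool.noConfusion h

end Weights

section Sums

variable [Fintype E] [DecidableEq E] [DecidableEq V]

omit [Fintype E] [DecidableEq E] [DecidableEq V] in
/-- A class sum is at least its lower bound times its size. -/
theorem card_mul_le_sum_of_forall {s : Finset (P.Term → Bool)} {b : ℤ} (h : ∀ x ∈ s, b ≤ P.weight x) :
    b * (s.card : ℤ) ≤ ∑ x ∈ s, P.weight x := by
  calc b * (s.card : ℤ) = ∑ _x ∈ s, b := by rw [Finset.sum_const, nsmul_eq_mul, mul_comm]
    _ ≤ ∑ x ∈ s, P.weight x := Finset.sum_le_sum h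

open Classical in
/-- **CASE (ii), general form**: for a validity predicate `val` kept by reddening, a gate carrying a 1-edge and a
2-edge gives `0 ≤ Σ_{x admissible, val x} weight x`. -/
theorem phi_nonneg_of_twoType_gate (val : (P.Term → Bool) → Prop)
    (hval : ∀ x C, val x → val (P.redden C x))
    {C : Finset V} (hC : P.IsGate C) {e₁ e₂ : P.Term} (he₁ : P.tz e₁.1 = C) (he₂ : P.tz e₂.1 = C)
    (hs₁ : P.ts e₁.1 = false) (hs₂ : P.ts e₂.1 = true) :
    0 ≤ ∑ x : P.Term → Bool, if P.Adm x ∧ val x then P.weight x else 0 := by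
  set S := (univ : Finset (P.Term → Bool)).filter fun x => P.Adm x ∧ val x with hS
  set RR := S.filter (fun x => P.AllRed C x) with hRR
  set S1 := S.filter (fun x => ¬ P.AllRed C x) with hS1
  set B₁ := S1.filter (fun x => P.AllBlue₁ C x) with hB₁
  set S2 := S1.filter (fun x => ¬ P.AllBlue₁ C x) with hS2
  set B₂ := S2.filter (fun x => P.AllBlue₂ C x) with hB₂
  set Rest := S2.filter (fun x => ¬ P.AllBlue₂ C x) with hRest
  have hsplit : (∑ x : P.Term → Bool, if P.Adm x ∧ val x then P.weight x else 0) =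
      ∑ x ∈ RR, P.weight x + ∑ x ∈ B₁, P.weight x + ∑ x ∈ B₂, P.weight x + ∑ x ∈ Rest, P.weight x := by
    rw [← Finset.sum_filter, ← hS, ← Finset.sum_filter_add_sum_filter_not S (fun x => P.AllRed C x),
      ← hRR, ← hS1, ← Finset.sum_filter_add_sum_filter_not S1 (fun x => P.AllBlue₁ C x), ← hB₁, ← hS2,
      ← Finset.sum_filter_add_sum_filter_not S2 (fun x => P.AllBlue₂ C x), ← hB₂, ← hRest]
    ring
  have hRRw : ∑ x ∈ RR, P.weight x = 4 * (RR.card : ℤ) := by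
    have h4 : ∀ x ∈ RR, P.weight x = 4 := by
      intro x hx
      rw [hRR, mem_filter] at hx
      exact weight_eq_four_of_allRed hC he₁ he₂ hs₁ hs₂ hx.2
    rw [Finset.sum_congr rfl h4, Finset.sum_const, nsmul_eq_mul, mul_comm]
  have hB₁w : -2 * (B₁.card : ℤ) ≤ ∑ x ∈ B₁, P.weight x :=
    card_mul_le_sum_of_forall fun x _ => neg_two_le_weight x
  have hB₂w : -2 * (B₂.card : ℤ) ≤ ∑ x ∈ B₂, P.weight x :=
    card_mul_le_sum_of_forall fun x _ => neg_two_le_weight x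
  have hRestw : 0 ≤ ∑ x ∈ Rest, P.weight x := by
    apply Finset.sum_nonneg
    intro x hx
    rw [hRest, mem_filter, hS2, mem_filter, hS1, mem_filter, hS, mem_filter] at hx
    have := one_le_weight_of_mixed hC hx.1.1.1.2.1 hx.1.1.2 hx.1.2 hx.2
    omega
  -- the injections into `RR`
  have hB₁c : B₁.card ≤ RR.card := by
    refine card_le_card_of_injOn (P.redden C) ?_ ?_
    · intro x hx
      rw [hB₁, coe_filter, hS1] at hx
      simp only [Set.mem_setOf_eq, mem_filter, hS, mem_univ, true_and] at hx
      rw [hRR, coe_filter]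
      simp only [Set.mem_setOf_eq, mem_filter, hS, mem_univ, true_and]
      exact ⟨⟨adm_redden hx.1.1.1 C, hval x C hx.1.1.2⟩, allRed_redden C x⟩
    · intro x hx y hy hxy
      rw [hB₁, coe_filter, hS1] at hx hy
      simp only [Set.mem_setOf_eq, mem_filter, hS, mem_univ, true_and] at hx hy
      exact redden_injOn₁ he₁ hs₁ ⟨hx.1.1.1, hx.2⟩ ⟨hy.1.1.1, hy.2⟩ hxy
  have hB₂c : B₂.card ≤ RR.card := by
    refine card_le_card_of_injOn (P.redden C) ?_ ?_
    · intro x hx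
      rw [hB₂, coe_filter, hS2, hS1] at hx
      simp only [Set.mem_setOf_eq, mem_filter, hS, mem_univ, true_and] at hx
      rw [hRR, coe_filter]
      simp only [Set.mem_setOf_eq, mem_filter, hS, mem_univ, true_and]
      exact ⟨⟨adm_redden hx.1.1.1.1 C, hval x C hx.1.1.1.2⟩, allRed_redden C x⟩
    · intro x hx y hy hxy
      rw [hB₂, coe_filter, hS2, hS1] at hx hy
      simp only [Set.mem_setOf_eq, mem_filter, hS, mem_univ, true_and] at hx hy
      exact redden_injOn₂ he₂ hs₂ ⟨hx.1.1.1.1, hx.2⟩ ⟨hy.1.1.1.1, hy.2⟩ hxy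
  rw [hsplit, hRRw]
  have h1 : (B₁.card : ℤ) ≤ RR.card := by exact_mod_cast hB₁c
  have h2 : (B₂.card : ℤ) ≤ RR.card := by exact_mod_cast hB₂c
  linarith

omit [Fintype E] [DecidableEq E] in
/-- Validity `X₁ ∨ X₂` is kept by reddening. -/
theorem valOr_redden (x : P.Term → Bool) (C : Finset V) (h : P.X₁ x ∨ P.X₂ x) :
    P.X₁ (P.redden C x) ∨ P.X₂ (P.redden C x) :=
  h.elim (fun h' => Or.inl (X₁_redden h' C)) (fun h' => Or.inr (X₂_redden h' C))

omit [Fintype E] [DecidableEq E] in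
/-- Validity `X₁ ∧ X₂` is kept by reddening. -/
theorem valAnd_redden (x : P.Term → Bool) (C : Finset V) (h : P.X₁ x ∧ P.X₂ x) :
    P.X₁ (P.redden C x) ∧ P.X₂ (P.redden C x) :=
  ⟨X₁_redden h.1 C, X₂_redden h.2 C⟩

open Classical in
/-- **CASE (ii) of THE LEMMA, `Φ∨`**: a gate carrying a 1-edge and a 2-edge gives `0 ≤ Φ∨ P`. -/
theorem phiOr_nonneg_of_twoType_gate {C : Finset V} (hC : P.IsGate C) {e₁ e₂ : P.Term}
    (he₁ : P.tz e₁.1 = C) (he₂ : P.tz e₂.1 = C) (hs₁ : P.ts e₁.1 = false) (hs₂ : P.ts e₂.1 = true) :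
    0 ≤ P.phiOr := by
  unfold phiOr
  convert phi_nonneg_of_twoType_gate (fun x => P.X₁ x ∨ P.X₂ x) valOr_redden hC he₁ he₂ hs₁ hs₂ using 3

open Classical in
/-- **CASE (ii) of THE LEMMA, `Φ∧`**: a gate carrying a 1-edge and a 2-edge gives `0 ≤ Φ∧ P`. -/
theorem phiAnd_nonneg_of_twoType_gate {C : Finset V} (hC : P.IsGate C) {e₁ e₂ : P.Term}
    (he₁ : P.tz e₁.1 = C) (he₂ : P.tz e₂.1 = C) (hs₁ : P.ts e₁.1 = false) (hs₂ : P.ts e₂.1 = true) :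
    0 ≤ P.phiAnd := by
  unfold phiAnd
  convert phi_nonneg_of_twoType_gate (fun x => P.X₁ x ∧ P.X₂ x) valAnd_redden hC he₁ he₂ hs₁ hs₂ using 3

end Sums

end Problem

end ZonePort

end PercRepro
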